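import Literature.AlgebraicGeometry.Morphisms.ProjectiveFrameTransporter
import Mathlib.AlgebraicGeometry.Morphisms.Separated
import HarnessLib

/-!
# The standard-frame slice of a framed `(d+2)`-tuple of points of `ℙᵈ`: the closed subscheme «the frame is the fundamental frame»

Topic `Literature/AlgebraicGeometry/Morphisms`; the sequel of `Morphisms/ProjectiveFrameLocus`
(the frame locus `U_R`, charts, global coordinates `topCoord`) and `Morphisms/ProjectiveFrameTransporter`
(the transporter morphism `T → GL_{d+1}` and its base change / chart change).

## The source, as printed

D. Mumford, J. Fogarty, F. Kirwan, *Geometric Invariant Theory*, 3rd ed. (1994), Ch. 3 §1, proof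
of **Proposition 3.1** (pp. 68–69) [held `book:mumford1994-geometric-invariant-theory`]: for the open
set `U_R ⊂ (P_n)^{m+1}` of Definition 3.3 (p. 68) there is «a `PGL(n+1)`-linear isomorphism (∗)
`U_R ≅ PGL(n+1) × A^{nr−n}`», obtained by moving the first `n + 2` points to the STANDARD position
`(1,0,…,0), …, (0,…,0,1), (1,1,…,1)` by the unique projectivity doing so; the second factor is the
SLICE `σ_R⁻¹(point)` = the closed subset of `U_R` where those points ARE in standard position, and
**Corollary 3.2** (p. 70): «Suppose `U ⊂ U_R` is any invariant open subset. Then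
`U ≅ PGL(n+1) × σ_R^{-1}(U)`». (With `r = 1`: `U_R` = ordered projective frames, slice = one point.)
R. Hartshorne, *Algebraic Geometry* (1977), II Thm. 7.1 (a): a morphism `T → ℙᵈ` is the data of
the sections `φ^*xᵢ`; U. Görtz, T. Wedhorn, *Algebraic Geometry I* (2020), Prop. 3.4:
`Hom(T, Spec A) = Hom(A, Γ(T, 𝒪_T))`.

## What is here (cell hodgecm-mathlib, item (ε2) of B-typ04 (g13); consumer = F-DAG leaf F-8 (8b)/(8c):
the slices `V_R ⊂ U_R ⊆ H` and their gluing)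

Everything in the COORDINATE currency of the two predecessors (a tuple `φ : Fin (d+2) → (T ⟶ ℙᵈ)`
read in one chart choice `c`, `hc : ∀ j, φ_j⁻¹D₊(x_{c j}) = T`, with global coordinate vectors
`topCoord φ c hc : Fin (d+2) → Fin (d+1) → Γ(T, 𝒪_T)`), DEFINITIONS WITH BODIES AND THEOREMS ONLY (no
named fact, no `sorry`, no `instance`, no notation):

* § 1 (rings, namespace `…ProjectiveSpace.ProjFrame`): the STANDARD CHART CHOICE `stdChart d`
  (point `a ≤ d` read in `D₊(x_a)`, the unit point in `D₊(x₀)`), `fundamentalFrame_stdChart`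
  (the fundamental frame is normalised for it), `isUnitFrame_fundamentalFrame`,
  `transporter_fundamentalFrame = 1`, `transporterGL_fundamentalFrame = 1`, `mapTuple_fundamentalFrame`.
* § 2 (schemes, namespace `…Morphisms.ProjFrame`): **the coordinate morphism
  `coordHom φ c hc : T ⟶ 𝔸^{(d+2)(d+1)}_ℤ = Spec ℤ[y_{j,i}]`**, `y_{j,i} ↦ topCoord φ c hc j i`
  (through `GroupSchemes/GeneralLinearGroupScheme.specHomEquiv`, Görtz–Wedhorn Prop. 3.4), its base
  change `comp_coordHom`, and the constant morphism **`fundamentalCoordHom T`**, `y_{j,i} ↦` the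
  entries of the fundamental frame (`comp_fundamentalCoordHom`); the criterion
  **`comp_coordHom_eq_comp_fundamentalCoordHom_iff`**: `x ≫ coordHom φ = x ≫ fundamentalCoordHom T`
  iff the coordinate vectors of the pulled-back tuple `(x ≫ φ_j)_j` ARE the fundamental frame.
* § 3 **the SLICE `slice φ c hc := equalizer (coordHom φ c hc) (fundamentalCoordHom T)`** with
  `sliceι : slice φ c hc ⟶ T` a CLOSED IMMERSION (`isClosedImmersion_sliceι`: Mathlib's instance for
  equalizers into a separated scheme, here an affine space); its universal property in coordinates
  (`sliceLift`, `sliceLift_ι`, `slice_hom_ext`, **`topCoord_sliceι_comp`**: on the slice the tuple IS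
  the fundamental frame; the factorisation criterion **`comp_sliceι_factors_iff`**: `x : T' → T`
  factors through `sliceι` iff the coordinate vectors of `(x ≫ φ_j)_j` are the fundamental frame),
  and `points_transporterHom_sliceι`: on the slice the transporter morphism is the unit of `GL_{d+1}`.
* § 4 **base change**: `sliceMap h : slice (h ≫ φ ·) c _ ⟶ slice φ c hc` over `h : T' ⟶ T` and
  **`isPullback_sliceMap`**: the slice of the pulled-back tuple is `T' ×_T slice φ` (what the (8c)
  gluing of the slices `V_R` consumes).

HC_CM is proved only modulo the 7 printed citations until rung 0 closes; this file is count-neutral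
capital (no binder, no fact).

## References

* [MumfordFogartyKirwan1994] D. Mumford, J. Fogarty, F. Kirwan, *Geometric Invariant Theory*, 3rd ed.,
  Ergebnisse 34, Springer (1994): Ch. 3 §1, Definition 3.3 (p. 68), Proposition 3.1 (pp. 68–69),
  Corollary 3.2 (p. 70).
* [BambergPenttila2023] J. Bamberg, T. Penttila, *Analytic Projective Geometry*, Cambridge (2023),
  §19.1 Theorem 19.5 (the fundamental frame).
* [Hartshorne1977] R. Hartshorne, *Algebraic Geometry*, GTM 52 (1977): II Thm. 7.1 (a) (p. 150).
* [GortzWedhorn2020] U. Görtz, T. Wedhorn, *Algebraic Geometry I: Schemes*, 2nd ed. (2020): Prop. 3.4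
  (morphisms into an affine scheme), (4.15) and Example 4.43 (1) (p. 116).
-/

noncomputable section

universe u

open CategoryTheory AlgebraicGeometry Limits HomogeneousLocalization TopologicalSpace Opposite Matrix
open scoped MatrixGroups
open MvPolynomial (X C)
open Literature.AlgebraicGeometry.Motives.Segre
open Literature.AlgebraicGeometry.Motives.GeneratingSections

attribute [local instance] MvPolynomial.gradedAlgebra

/-! ## § 1 The standard chart choice; the fundamental frame is a frame with transporter `1` -/

namespace Literature.AlgebraicGeometry.ProjectiveSpace.ProjFrame

variable {A : Type u} {d : ℕ}

/-- **The standard chart choice** for the fundamental frame: the point `a ≤ d` is read in the chart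
`D₊(x_a)`, the unit point `d + 1` in the chart `D₊(x₀)`. [cite: MumfordFogartyKirwan1994, Ch. 3 Proposition 3.1] -/
def stdChart (d : ℕ) : Fin (d + 2) → Fin (d + 1) :=
  fun j => Fin.lastCases (motive := fun _ => Fin (d + 1)) 0 (fun a => a) j

/-- `stdChart d a = a` for `a ≤ d`. [cite: MumfordFogartyKirwan1994, Ch. 3 Proposition 3.1] -/
@[simp]
theorem stdChart_castSucc (a : Fin (d + 1)) : stdChart d a.castSucc = a :=
  Fin.lastCases_castSucc (motive := fun _ => Fin (d + 1)) a

/-- `stdChart d (d+1) = 0`. [cite: MumfordFogartyKirwan1994, Ch. 3 Proposition 3.1] -/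
@[simp]
theorem stdChart_last : stdChart d (Fin.last (d + 1)) = 0 :=
  Fin.lastCases_last (motive := fun _ => Fin (d + 1))

variable [CommRing A]

/-- The fundamental frame is NORMALISED for the standard chart choice: its `j`-th vector has
`stdChart d j`-th coordinate `1`. [cite: BambergPenttila2023, §19.1 Theorem 19.5] -/
theorem fundamentalFrame_stdChart (j : Fin (d + 2)) : fundamentalFrame d A j (stdChart d j) = 1 := by
  induction j using Fin.lastCases with
  | last => rw [stdChart_last, fundamentalFrame_last]
  | cast a => rw [stdChart_castSucc, fundamentalFrame_castSucc, Pi.single_eq_same]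

/-- The Cramer determinants of the fundamental frame are all `1`. [cite: BambergPenttila2023, §19.1 Theorem 19.5] -/
theorem cramerVec_fundamentalFrame (i : Fin (d + 1)) : cramerVec (fundamentalFrame d A) i = 1 := by
  rw [cramerVec, simplexMatrix_fundamentalFrame, Matrix.cramer_one, Module.End.one_apply,
    fundamentalFrame_last]

/-- **The fundamental frame is a unit frame.** [cite: MumfordFogartyKirwan1994, Ch. 3 Definition 3.3] -/
theorem isUnitFrame_fundamentalFrame : IsUnitFrame (fundamentalFrame d A) :=
  ⟨by rw [simplexMatrix_fundamentalFrame, Matrix.det_one]; exact isUnit_one,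
    fun i => by rw [cramerVec_fundamentalFrame]; exact isUnit_one⟩

/-- **The transporter of the fundamental frame is the identity matrix.**
[cite: BambergPenttila2023, §19.1 Theorem 19.5] -/
theorem transporter_fundamentalFrame : transporter (fundamentalFrame d A) = 1 := by
  have h : cramerVec (fundamentalFrame d A) = fun _ => 1 := funext cramerVec_fundamentalFrame
  rw [transporter, simplexMatrix_fundamentalFrame, Matrix.one_mul, h]
  exact Matrix.diagonal_one

/-- … and so is `transporterGL` of the fundamental frame, as an element of `GL_{d+1}(A)`.
[cite: MumfordFogartyKirwan1994, Ch. 3 Proposition 3.1] -/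
theorem transporterGL_fundamentalFrame (h : IsUnitFrame (fundamentalFrame d A)) :
    transporterGL (fundamentalFrame d A) h = 1 :=
  Units.ext (by rw [coe_transporterGL, transporter_fundamentalFrame, Units.val_one])

/-- The fundamental frame is preserved by every ring map (its entries are `0` and `1`).
[cite: BambergPenttila2023, §19.1 Theorem 19.5] -/
theorem mapTuple_fundamentalFrame {A' : Type u} [CommRing A'] (φ : A →+* A') :
    mapTuple φ (fundamentalFrame d A) = fundamentalFrame d A' := by
  funext j i
  induction j using Fin.lastCases with
  | last => rw [mapTuple_apply, fundamentalFrame_last, fundamentalFrame_last, map_one]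
  | cast a =>
      rw [mapTuple_apply, fundamentalFrame_castSucc, fundamentalFrame_castSucc, Pi.single_apply,
        Pi.single_apply]
      split_ifs
      · exact map_one φ
      · exact map_zero φ

end Literature.AlgebraicGeometry.ProjectiveSpace.ProjFrame

/-! ## § 2 The coordinate morphism `T → 𝔸^{(d+2)(d+1)}_ℤ` of a one-chart tuple -/

namespace Literature.AlgebraicGeometry.Morphisms.ProjFrame

open Literature.AlgebraicGeometry.ProjectiveSpace.ProjFrame
open Literature.AlgebraicGeometry.GroupSchemes.GeneralLinearGroupScheme (GLScheme points points_comp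
  specHomEquiv specHomEquiv_comp intCast)

variable {k : Type u} [CommRing k] {d : ℕ} {T T' : Scheme.{u}}
  (φ : Fin (d + 2) → (T ⟶ Proj (grading (Fin (d + 1)) k)))
  (c : Fin (d + 2) → Fin (d + 1)) (hc : ∀ j, preU (φ j) (c j) = ⊤)

/-- The coordinate ring of the affine space of `(d+2) × (d+1)` matrices over `ℤ`:
`ℤ[y_{j,i} : j < d+2, i < d+1]` (in universe `u`). [cite: GortzWedhorn2020, Prop. 3.4] -/
abbrev coordPolyRing (d : ℕ) : Type u := MvPolynomial (Fin (d + 2) × Fin (d + 1)) (ULift.{u} ℤ)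

/-- The affine space `𝔸^{(d+2)(d+1)}_ℤ = Spec ℤ[y_{j,i}]` receiving the coordinate morphisms.
[cite: GortzWedhorn2020, Prop. 3.4] -/
abbrev coordSpace (d : ℕ) : Scheme.{u} := Spec (CommRingCat.of (coordPolyRing.{u} d))

/-- Ring homomorphisms out of `ULift ℤ` agree. [folklore] -/
private theorem ringHom_ulift_int_ext {B : Type u} [CommRing B] (f g : ULift.{u} ℤ →+* B) : f = g := by
  have h : f.comp ULift.ringEquiv.{0, u}.symm.toRingHom = g.comp ULift.ringEquiv.symm.toRingHom :=
    Subsingleton.elim _ _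
  refine RingHom.ext fun x => ?_
  exact RingHom.congr_fun h x.down

/-- Two ring maps out of `ℤ[y_{j,i}]` agreeing on the variables are equal. [folklore] -/
private theorem coordPolyRing_ringHom_ext {B : Type u} [CommRing B] {f g : coordPolyRing.{u} d →+* B}
    (h : ∀ p, f (X p) = g (X p)) : f = g :=
  MvPolynomial.ringHom_ext' (ringHom_ulift_int_ext _ _) h

/-- Evaluation of `ℤ[y_{j,i}]` at a tuple of vectors `P` over a ring `B`: `y_{j,i} ↦ P j i` (the
`B`-points of `𝔸^{(d+2)(d+1)}_ℤ`, Görtz–Wedhorn Prop. 3.4). [cite: GortzWedhorn2020, Prop. 3.4] -/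
def evalTuple {B : Type u} [CommRing B] (P : Fin (d + 2) → Fin (d + 1) → B) : coordPolyRing.{u} d →+* B :=
  MvPolynomial.eval₂Hom (intCast B) fun p => P p.1 p.2

/-- `evalTuple P (y_{j,i}) = P j i`. [cite: GortzWedhorn2020, Prop. 3.4] -/
@[simp]
theorem evalTuple_X {B : Type u} [CommRing B] (P : Fin (d + 2) → Fin (d + 1) → B) (p : Fin (d + 2) × Fin (d + 1)) :
    evalTuple P (X p) = P p.1 p.2 :=
  MvPolynomial.eval₂Hom_X' _ _ _

/-- Naturality of `evalTuple`: `f ∘ evalTuple P = evalTuple (f ∘ P)` (functoriality of the points of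
affine space). [cite: GortzWedhorn2020, Prop. 3.4] -/
theorem comp_evalTuple {B B' : Type u} [CommRing B] [CommRing B'] (f : B →+* B')
    (P : Fin (d + 2) → Fin (d + 1) → B) : f.comp (evalTuple P) = evalTuple (mapTuple f P) :=
  coordPolyRing_ringHom_ext fun p => by rw [RingHom.comp_apply, evalTuple_X, evalTuple_X, mapTuple_apply]

/-- `evalTuple` is injective in the tuple (a point of affine space is its coordinates).
[cite: GortzWedhorn2020, Prop. 3.4] -/
theorem evalTuple_injective {B : Type u} [CommRing B] :
    Function.Injective (evalTuple (d := d) (B := B)) := by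
  intro P Q h
  funext j i
  have := congrArg (fun f => f (X (j, i))) h
  simpa only [evalTuple_X] using this

/-- `topCoord` only depends on the tuple (proof-irrelevance helper for rewriting the tuple, e.g. by
associativity of composition, under the one-chart hypothesis). [cite: Hartshorne1977, II Thm. 7.1 (a)] -/
theorem topCoord_congr {ψ ψ' : Fin (d + 2) → (T ⟶ Proj (grading (Fin (d + 1)) k))} (e : ψ = ψ')
    (hψ : ∀ j, preU (ψ j) (c j) = ⊤) (hψ' : ∀ j, preU (ψ' j) (c j) = ⊤) :
    topCoord ψ c hψ = topCoord ψ' c hψ' := by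
  subst e
  rfl

/-- **The coordinate morphism** of the one-chart tuple `φ`: `T → 𝔸^{(d+2)(d+1)}_ℤ`,
`y_{j,i} ↦ topCoord φ c hc j i = φ_j^*(xᵢ/x_{c j})` (Görtz–Wedhorn Prop. 3.4: a morphism into an affine
scheme is a ring map into `Γ(T, 𝒪_T)`). [cite: Hartshorne1977, II Thm. 7.1 (a)] -/
def coordHom : T ⟶ coordSpace.{u} d :=
  (specHomEquiv T (CommRingCat.of (coordPolyRing.{u} d))).symm (evalTuple (topCoord φ c hc))

/-- The ring map of `coordHom` is `evalTuple (topCoord φ c hc)`. [cite: GortzWedhorn2020, Prop. 3.4] -/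
@[simp]
theorem specHomEquiv_coordHom :
    specHomEquiv T (CommRingCat.of (coordPolyRing.{u} d)) (coordHom φ c hc) = evalTuple (topCoord φ c hc) :=
  Equiv.apply_symm_apply _ _

/-- **The coordinate morphism commutes with base change**: `h ≫ coordHom φ = coordHom (h ≫ φ ·)`
(`ProjFrame.topCoord_comp`). [cite: Hartshorne1977, II Thm. 7.1 (a)] -/
theorem comp_coordHom (h : T' ⟶ T) :
    h ≫ coordHom φ c hc = coordHom (fun j => h ≫ φ j) c (preU_comp_eq_top φ c hc h) := by
  apply (specHomEquiv T' (CommRingCat.of (coordPolyRing.{u} d))).injective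
  rw [specHomEquiv_comp, specHomEquiv_coordHom, specHomEquiv_coordHom, comp_evalTuple,
    mapTuple_topCoord]

/-- **The constant morphism «fundamental frame»**: `T → 𝔸^{(d+2)(d+1)}_ℤ`, `y_{j,i} ↦` the
`(j,i)` entry of the fundamental frame `(e₀, …, e_d, Σ eᵢ)` (`0` or `1`).
[cite: BambergPenttila2023, §19.1 Theorem 19.5] -/
def fundamentalCoordHom (d : ℕ) (T : Scheme.{u}) : T ⟶ coordSpace.{u} d :=
  (specHomEquiv T (CommRingCat.of (coordPolyRing.{u} d))).symm (evalTuple (fundamentalFrame d Γ(T, ⊤)))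

/-- The ring map of `fundamentalCoordHom`. [cite: GortzWedhorn2020, Prop. 3.4] -/
@[simp]
theorem specHomEquiv_fundamentalCoordHom :
    specHomEquiv T (CommRingCat.of (coordPolyRing.{u} d)) (fundamentalCoordHom d T) =
      evalTuple (fundamentalFrame d Γ(T, ⊤)) :=
  Equiv.apply_symm_apply _ _

/-- The constant morphism commutes with base change. [cite: BambergPenttila2023, §19.1 Theorem 19.5] -/
theorem comp_fundamentalCoordHom (h : T' ⟶ T) :
    h ≫ fundamentalCoordHom d T = fundamentalCoordHom d T' := by
  apply (specHomEquiv T' (CommRingCat.of (coordPolyRing.{u} d))).injective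
  rw [specHomEquiv_comp, specHomEquiv_fundamentalCoordHom, specHomEquiv_fundamentalCoordHom,
    comp_evalTuple, mapTuple_fundamentalFrame]

/-- **The slice criterion on `T'`-points**: `x ≫ coordHom φ = x ≫ fundamentalCoordHom T` iff the
coordinate vectors of the pulled-back tuple `(x ≫ φ_j)_j` ARE the fundamental frame over `Γ(T', 𝒪)`.
[cite: MumfordFogartyKirwan1994, Ch. 3 Proposition 3.1] -/
theorem comp_coordHom_eq_comp_fundamentalCoordHom_iff (x : T' ⟶ T) :
    x ≫ coordHom φ c hc = x ≫ fundamentalCoordHom d T ↔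
      topCoord (fun j => x ≫ φ j) c (preU_comp_eq_top φ c hc x) = fundamentalFrame d Γ(T', ⊤) := by
  rw [comp_coordHom, comp_fundamentalCoordHom,
    ← (specHomEquiv T' (CommRingCat.of (coordPolyRing.{u} d))).injective.eq_iff,
    specHomEquiv_coordHom, specHomEquiv_fundamentalCoordHom, evalTuple_injective.eq_iff]

/-! ## § 3 The slice -/

/-- **The STANDARD-FRAME SLICE** of the one-chart tuple `φ`: the equalizer of its coordinate morphism
and the constant morphism «fundamental frame» — MFK's `σ_R⁻¹(point) ⊂ U_R`, the locus where the
frame IS the standard frame (proof of Prop. 3.1). An `abbrev` (like `sliceι`), so that Mathlib's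
instances for `equalizer.ι` (closed immersion, mono) are found on it.
[cite: MumfordFogartyKirwan1994, Ch. 3 Proposition 3.1] -/
abbrev slice : Scheme.{u} :=
  equalizer (coordHom φ c hc) (fundamentalCoordHom d T)

/-- The inclusion of the slice into `T`. [cite: MumfordFogartyKirwan1994, Ch. 3 Proposition 3.1] -/
abbrev sliceι : slice φ c hc ⟶ T :=
  equalizer.ι (coordHom φ c hc) (fundamentalCoordHom d T)

/-- Unfolding `sliceι`. [cite: MumfordFogartyKirwan1994, Ch. 3 Proposition 3.1] -/
theorem sliceι_def : sliceι φ c hc = equalizer.ι (coordHom φ c hc) (fundamentalCoordHom d T) := rfl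

/-- **The slice is a CLOSED subscheme of `T`**: `sliceι` is a closed immersion (Mathlib: the
equalizer of two morphisms into a separated scheme is a closed subscheme; affine space is separated).
[cite: MumfordFogartyKirwan1994, Ch. 3 Proposition 3.1] -/
theorem isClosedImmersion_sliceι : IsClosedImmersion (sliceι φ c hc) :=
  inferInstance

/-- The slice inclusion is a monomorphism. [cite: MumfordFogartyKirwan1994, Ch. 3 Proposition 3.1] -/
theorem mono_sliceι : Mono (sliceι φ c hc) :=
  inferInstance

/-- The defining equation on the slice. [cite: MumfordFogartyKirwan1994, Ch. 3 Proposition 3.1] -/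
theorem sliceι_comp_coordHom :
    sliceι φ c hc ≫ coordHom φ c hc = sliceι φ c hc ≫ fundamentalCoordHom d T :=
  equalizer.condition _ _

/-- **On the slice the tuple IS the fundamental frame** (in the coordinates of the chart choice `c`).
[cite: MumfordFogartyKirwan1994, Ch. 3 Proposition 3.1] -/
theorem topCoord_sliceι_comp :
    topCoord (fun j => sliceι φ c hc ≫ φ j) c (preU_comp_eq_top φ c hc (sliceι φ c hc)) =
      fundamentalFrame d Γ(slice φ c hc, ⊤) :=
  (comp_coordHom_eq_comp_fundamentalCoordHom_iff φ c hc _).mp (sliceι_comp_coordHom φ c hc)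

/-- Hence the tuple restricted to the slice is a unit frame. [cite: MumfordFogartyKirwan1994, Ch. 3 Definition 3.3] -/
theorem isUnitFrame_topCoord_sliceι_comp :
    IsUnitFrame (topCoord (fun j => sliceι φ c hc ≫ φ j) c (preU_comp_eq_top φ c hc (sliceι φ c hc))) := by
  rw [topCoord_sliceι_comp]
  exact isUnitFrame_fundamentalFrame

/-- **On the slice the transporter morphism is the unit section of `GL_{d+1}`.**
[cite: MumfordFogartyKirwan1994, Ch. 3 Proposition 3.1] -/
theorem points_transporterHom_sliceι
    (hP : IsUnitFrame (topCoord (fun j => sliceι φ c hc ≫ φ j) c (preU_comp_eq_top φ c hc (sliceι φ c hc)))) :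
    points _ (transporterHom (fun j => sliceι φ c hc ≫ φ j) c (preU_comp_eq_top φ c hc (sliceι φ c hc)) hP) = 1 := by
  rw [points_transporterHom, transporterGL_congr (topCoord_sliceι_comp φ c hc) hP isUnitFrame_fundamentalFrame]
  exact transporterGL_fundamentalFrame _

/-- **Universal property of the slice (existence)**: a `T'`-point `x` of `T` whose pulled-back tuple has
the fundamental frame as coordinate vectors factors through the slice.
[cite: MumfordFogartyKirwan1994, Ch. 3 Proposition 3.1] -/
def sliceLift (x : T' ⟶ T)
    (hx : topCoord (fun j => x ≫ φ j) c (preU_comp_eq_top φ c hc x) = fundamentalFrame d Γ(T', ⊤)) :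
    T' ⟶ slice φ c hc :=
  equalizer.lift x ((comp_coordHom_eq_comp_fundamentalCoordHom_iff φ c hc x).mpr hx)

/-- `sliceLift x hx ≫ sliceι = x`. [cite: MumfordFogartyKirwan1994, Ch. 3 Proposition 3.1] -/
@[simp]
theorem sliceLift_ι (x : T' ⟶ T)
    (hx : topCoord (fun j => x ≫ φ j) c (preU_comp_eq_top φ c hc x) = fundamentalFrame d Γ(T', ⊤)) :
    sliceLift φ c hc x hx ≫ sliceι φ c hc = x :=
  equalizer.lift_ι _ _

/-- **Universal property of the slice (uniqueness)**: two morphisms into the slice agreeing after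
`sliceι` are equal. [cite: MumfordFogartyKirwan1994, Ch. 3 Proposition 3.1] -/
theorem slice_hom_ext {a b : T' ⟶ slice φ c hc} (h : a ≫ sliceι φ c hc = b ≫ sliceι φ c hc) : a = b :=
  equalizer.hom_ext h

/-- **`T'`-points of the slice**: a morphism `x : T' → T` factors through `sliceι` iff the coordinate
vectors of `(x ≫ φ_j)_j` are the fundamental frame. [cite: MumfordFogartyKirwan1994, Ch. 3 Proposition 3.1] -/
theorem comp_sliceι_factors_iff (x : T' ⟶ T) :
    (∃ y : T' ⟶ slice φ c hc, y ≫ sliceι φ c hc = x) ↔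
      topCoord (fun j => x ≫ φ j) c (preU_comp_eq_top φ c hc x) = fundamentalFrame d Γ(T', ⊤) := by
  constructor
  · rintro ⟨y, rfl⟩
    rw [← comp_coordHom_eq_comp_fundamentalCoordHom_iff φ c hc (y ≫ sliceι φ c hc), Category.assoc,
      Category.assoc, sliceι_comp_coordHom]
  · exact fun hx => ⟨sliceLift φ c hc x hx, sliceLift_ι φ c hc x hx⟩

/-! ## § 4 Base change of the slice -/

section BaseChange

variable (h : T' ⟶ T)

/-- The coordinates of `sliceι (h ≫ φ ·) ≫ h ≫ φ` are the fundamental frame (so the base-changed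
slice maps to the slice). [cite: MumfordFogartyKirwan1994, Ch. 3 Proposition 3.1] -/
theorem topCoord_sliceι_comp_comp :
    topCoord (fun j => (sliceι (fun j => h ≫ φ j) c (preU_comp_eq_top φ c hc h) ≫ h) ≫ φ j) c
        (preU_comp_eq_top φ c hc _) =
      fundamentalFrame d Γ(slice (fun j => h ≫ φ j) c (preU_comp_eq_top φ c hc h), ⊤) := by
  rw [topCoord_congr c (funext fun j => Category.assoc _ _ _) _
    (preU_comp_eq_top (fun j => h ≫ φ j) c (preU_comp_eq_top φ c hc h) _)]
  exact topCoord_sliceι_comp (fun j => h ≫ φ j) c (preU_comp_eq_top φ c hc h)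

/-- **The comparison morphism** `slice (h ≫ φ ·) → slice φ` over `h : T' → T`.
[cite: MumfordFogartyKirwan1994, Ch. 3 Proposition 3.1] -/
def sliceMap : slice (fun j => h ≫ φ j) c (preU_comp_eq_top φ c hc h) ⟶ slice φ c hc :=
  sliceLift φ c hc (sliceι (fun j => h ≫ φ j) c (preU_comp_eq_top φ c hc h) ≫ h)
    (topCoord_sliceι_comp_comp φ c hc h)

/-- The comparison square commutes: `sliceMap ≫ sliceι φ = sliceι (h ≫ φ ·) ≫ h`.
[cite: MumfordFogartyKirwan1994, Ch. 3 Proposition 3.1] -/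
@[simp]
theorem sliceMap_ι :
    sliceMap φ c hc h ≫ sliceι φ c hc = sliceι (fun j => h ≫ φ j) c (preU_comp_eq_top φ c hc h) ≫ h :=
  sliceLift_ι φ c hc _ _

/-- **The slice commutes with base change**: `slice (h ≫ φ ·) = T' ×_T slice φ`, i.e. the square
`sliceι (h ≫ φ ·), sliceMap ; h, sliceι φ` is cartesian (the equalizer of a pulled-back pair is the
pull-back of the equalizer; here by the universal properties in coordinates).
[cite: MumfordFogartyKirwan1994, Ch. 3 Proposition 3.1] -/
theorem isPullback_sliceMap :
    IsPullback (sliceι (fun j => h ≫ φ j) c (preU_comp_eq_top φ c hc h)) (sliceMap φ c hc h) h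
      (sliceι φ c hc) := by
  refine IsPullback.of_isLimit' ⟨(sliceMap_ι φ c hc h).symm⟩ ?_
  refine PullbackCone.IsLimit.mk _ (fun s => sliceLift (fun j => h ≫ φ j) c (preU_comp_eq_top φ c hc h)
      s.fst ?_) (fun s => ?_) (fun s => ?_) (fun s m hm₁ _ => ?_)
  · -- the coordinates of `s.fst ≫ h ≫ φ` are those of `s.snd ≫ sliceι ≫ φ`: the fundamental frame
    have key : topCoord (fun j => (s.snd ≫ sliceι φ c hc) ≫ φ j) c (preU_comp_eq_top φ c hc _) =
        fundamentalFrame d Γ(s.pt, ⊤) :=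
      (comp_sliceι_factors_iff φ c hc (s.snd ≫ sliceι φ c hc)).mp ⟨s.snd, rfl⟩
    have hcond : s.fst ≫ h = s.snd ≫ sliceι φ c hc := s.condition
    have e : (fun j => s.fst ≫ h ≫ φ j) = fun j => (s.snd ≫ sliceι φ c hc) ≫ φ j :=
      funext fun j => by rw [← Category.assoc, hcond]
    rw [topCoord_congr c e _ (preU_comp_eq_top φ c hc _)]
    exact key
  · exact sliceLift_ι _ c _ _ _
  · apply slice_hom_ext φ c hc
    rw [Category.assoc, sliceMap_ι, ← Category.assoc, sliceLift_ι]
    exact s.condition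
  · apply slice_hom_ext (fun j => h ≫ φ j) c (preU_comp_eq_top φ c hc h)
    rw [sliceLift_ι]
    exact hm₁

end BaseChange

end Literature.AlgebraicGeometry.Morphisms.ProjFrame

end
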